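import Literature.Probability.LatticeModels.CISWeakClosure
import Mathlib.Probability.Kernel.Composition.MeasureCompProd
import HarnessLib

/-!
# Colangelo–Müller–Scarsini's density-free CIS (Definition 4) in dimension `≥ 3`: a scope defect

Cell `prim-sahi`, typer (generation 17); `--supports stmt-CriticalPhenomena-4575`.  Theorems only (no definitions,
no named facts, no sorries).

The tree's `Literature.Probability.LatticeModels.ConditionallyIncreasing.IsCIS` is Colangelo–Müller–Scarsini's
Definition 4 VERBATIM (J. Appl. Probab. 43 (2006), §4 p. 55): `µ(U ∩ Â) µ(B̂) ≤ µ(U ∩ B̂) µ(Â)` for the initial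
segments `J = {i < k}`, all Borel `A < B ⊆ ℝ^J` and all measurable up-sets `U`, where — as printed (§3 p. 51) —
`A < B` means `a_j < b_j` for EVERY coordinate `j ∈ J` and all `a ∈ A`, `b ∈ B` (`SetLT`).  In dimension `d ≤ 2`
(one conditioning coordinate) this is the classical notion.  With TWO OR MORE conditioning coordinates the strict
separation in every coordinate is too weak: it never compares two conditioning points that share a coordinate.
This file records the consequence as kernel-checked facts:

* `condIncrGiven_of_ae_eval_eq_const` — if some conditioning coordinate `X_i`, `i ∈ J`, is a.s. CONSTANT, then
  Definition 4's inequality given `X_J` holds for EVERY law (one of `Â`, `B̂` is null); hence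
  `isCIS_of_ae_eval_zero_eq_const`: **every law on `ℝ^{d+1}` whose first coordinate is a.s. constant is CIS in
  the sense of Definition 4**, whatever the joint law of the remaining coordinates.
* `cmsExample` — the law of `(0, ξ, 1 − ξ)`, `ξ` a fair coin, on `ℝ³`: it is Definition-4-CIS
  (`isCIS_cmsExample`), but its last two coordinates are NEGATIVELY quadrant dependent
  (`cmsExample_not_pqd`: `µ{x₁ > ½} µ{x₂ > ½} = ¼ > 0 = µ{x₁ > ½, x₂ > ½}`), so it is not positively associated,
  violates axiom B1 of §2, is not CI (`not_condIncrGiven_cmsExample_one`), and — `cmsExample_no_increasing_kernel` —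
  admits NO stochastically increasing disintegration kernel of `X₂` given `(X₀, X₁)` (the two atoms `(0,0) ≤ (0,1)`
  of the conditioning law carry the conditional laws `δ₁`, `δ₀`).  Consequently the implication (a) ⇒ (b) of
  Theorem 4 of the source ("µ is CIS ⇒ for every k there exists a stochastically increasing kernel `K_{k,1}` with
  `µ^{(k+1)} = µ^{(k)} ∗ K_{k,1}`") FAILS AS PRINTED for `d = 3`; what survives is recorded in the companion files
  `SahiCISCoupling.lean` / `SahiCISPositivity.lean` (the almost-everywhere kernel notion, its monotone coupling to
  Lebesgue measure, positive association and Sahi positivity), and the closure Theorem 5 of the source is a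
  statement about Definition 4, not about the kernel notion (companion `SahiCISNonClosure.lean`).

References: A. Colangelo, A. Müller, M. Scarsini, *Positive dependence and weak convergence*, J. Appl. Probab. 43
(2006) 48–59, §2 (B1), §3 p. 51 (`C < D`), §4 Definition 4, Theorem 4, Theorem 6. [ColangeloMullerScarsini2006]
A. Müller, D. Stoyan, *Comparison Methods for Stochastic Models and Risks*, Wiley 2002, Def. 3.10.9 (CIS),
Thm. 3.10.11 (CIS ⇒ associated). [MullerStoyan2002]
-/

noncomputable section

namespace Summit.CriticalPhenomena.PercolationContinuityZ3.Theorems.SahiCIS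

open MeasureTheory ProbabilityTheory Set Filter
open Literature.Probability.LatticeModels.ConditionallyIncreasing
open scoped ENNReal

/-! ### Definition 4 is blind to conditioning points sharing a coordinate -/

section Degenerate

variable {ι : Type*} {μ : Measure (ι → ℝ)}

/-- If a conditioning coordinate `X_i` (`i ∈ J`) is almost surely equal to a constant `c`, then for strictly
separated `A < B ⊆ ℝ^J` at least one of the cylinders `Â`, `B̂` is null: two points of positive-mass parts would
have `i`-th coordinates `c < c`. [this work] -/
theorem measure_cyl_eq_zero_or_of_ae_eval_eq_const {J : Finset ι} {i : ι} (hi : i ∈ J) {c : ℝ}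
    (hμ : ∀ᵐ x ∂μ, x i = c) {A B : Set (↥J → ℝ)} (hAB : SetLT A B) :
    μ (cyl J A) = 0 ∨ μ (cyl J B) = 0 := by
  by_contra h
  rw [not_or] at h
  obtain ⟨hA, hB⟩ := h
  have hN : μ {x | x i = c}ᶜ = 0 := by
    have := (ae_iff.1 hμ)
    simpa [Set.compl_setOf] using this
  have hcarry : ∀ S : Set (ι → ℝ), μ S ≤ μ (S ∩ {x | x i = c}) := fun S =>
    calc μ S ≤ μ ((S ∩ {x | x i = c}) ∪ {x | x i = c}ᶜ) := measure_mono fun z hz => by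
          by_cases hzc : z i = c
          · exact Or.inl ⟨hz, hzc⟩
          · exact Or.inr hzc
      _ ≤ μ (S ∩ {x | x i = c}) + μ {x | x i = c}ᶜ := measure_union_le _ _
      _ = μ (S ∩ {x | x i = c}) := by rw [hN, add_zero]
  have hA' : μ (cyl J A ∩ {x | x i = c}) ≠ 0 := fun h0 => hA (nonpos_iff_eq_zero.1 ((hcarry _).trans h0.le))
  have hB' : μ (cyl J B ∩ {x | x i = c}) ≠ 0 := fun h0 => hB (nonpos_iff_eq_zero.1 ((hcarry _).trans h0.le))
  obtain ⟨x, hxA, hxc⟩ := nonempty_of_measure_ne_zero hA'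
  obtain ⟨y, hyB, hyc⟩ := nonempty_of_measure_ne_zero hB'
  have hlt : x i < y i := hAB (J.restrict x) hxA (J.restrict y) hyB ⟨i, hi⟩
  rw [show x i = c from hxc, show y i = c from hyc] at hlt
  exact lt_irrefl _ hlt

/-- **Definition 4 holds vacuously when a conditioning coordinate is a.s. constant.** If `X_i = c` a.s. for some
`i ∈ J`, then `µ(U ∩ Â) µ(B̂) ≤ µ(U ∩ B̂) µ(Â)` for all strictly separated Borel `A < B ⊆ ℝ^J` and all up-sets
`U` — for EVERY law `µ`, whatever the dependence among the other coordinates. [this work] -/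
theorem condIncrGiven_of_ae_eval_eq_const {J : Finset ι} {i : ι} (hi : i ∈ J) {c : ℝ}
    (hμ : ∀ᵐ x ∂μ, x i = c) : CondIncrGiven μ J := by
  intro A B _ _ hAB U _ _
  rcases measure_cyl_eq_zero_or_of_ae_eval_eq_const hi hμ hAB with h0 | h0
  · rw [measure_mono_null Set.inter_subset_right h0, zero_mul]
    exact bot_le
  · rw [h0, mul_zero]
    exact bot_le

/-- Definition 4 given NO coordinate (`J = ∅`) is an identity for every law: the cylinders over `ℝ^∅` are `∅`
or everything. [folklore] -/
theorem condIncrGiven_empty (μ : Measure (ι → ℝ)) : CondIncrGiven μ (∅ : Finset ι) := by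
  intro A B _ _ _ U _ _
  have hconst : ∀ z z' : ι → ℝ, (∅ : Finset ι).restrict z = (∅ : Finset ι).restrict z' := fun z z' =>
    funext fun j => (Finset.notMem_empty _ j.2).elim
  have hdich : ∀ C : Set (↥(∅ : Finset ι) → ℝ), cyl ∅ C = ∅ ∨ cyl ∅ C = Set.univ := by
    intro C
    by_cases hC : (cyl (∅ : Finset ι) C).Nonempty
    · obtain ⟨z₀, hz₀⟩ := hC
      refine Or.inr (Set.eq_univ_of_forall fun z => ?_)
      show (∅ : Finset ι).restrict z ∈ C
      rw [hconst z z₀]; exact hz₀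
    · exact Or.inl (Set.not_nonempty_iff_eq_empty.1 hC)
  rcases hdich A with hA | hA
  · rw [hA, Set.inter_empty, measure_empty, zero_mul]; exact bot_le
  rcases hdich B with hB | hB
  · rw [hB, measure_empty, mul_zero]; exact bot_le
  rw [hA, hB]

/-- **Every law on `ℝ^{d+1}` whose first coordinate is a.s. constant is CIS in the sense of Definition 4** of
Colangelo–Müller–Scarsini: the first coordinate belongs to every nonempty initial segment of conditioning
coordinates. [this work] -/
theorem isCIS_of_ae_eval_zero_eq_const {d : ℕ} {μ : Measure (Fin (d + 1) → ℝ)} {c : ℝ}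
    (hμ : ∀ᵐ x ∂μ, x 0 = c) : IsCIS μ := by
  intro k
  by_cases hk : (0 : Fin (d + 1)) < k
  · exact condIncrGiven_of_ae_eval_eq_const (Finset.mem_filter.2 ⟨Finset.mem_univ _, hk⟩) hμ
  · have hk0 : k = 0 := le_antisymm (not_lt.1 hk) (Fin.zero_le _)
    have hJ : (Finset.univ.filter fun i : Fin (d + 1) => i < k) = ∅ := by
      rw [hk0]
      exact Finset.filter_eq_empty_iff.2 fun i _ => by simp
    rw [hJ]
    exact condIncrGiven_empty μ

end Degenerate

/-! ### The example `(0, ξ, 1 − ξ)` on `ℝ³` -/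

section Example

/-- The atom `(0, 0, 1)`. -/
def atomA : Fin 3 → ℝ := ![0, 0, 1]

/-- The atom `(0, 1, 0)`. -/
def atomB : Fin 3 → ℝ := ![0, 1, 0]

/-- **The example**: the law of `(0, ξ, 1 − ξ)` for a fair coin `ξ`, i.e. `½ δ_{(0,0,1)} + ½ δ_{(0,1,0)}` on `ℝ³`.
[this work] -/
def cmsExample : Measure (Fin 3 → ℝ) :=
  (2⁻¹ : ℝ≥0∞) • Measure.dirac atomA + (2⁻¹ : ℝ≥0∞) • Measure.dirac atomB

/-- Coordinate `0` of `(0,0,1)`. [folklore] -/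
@[simp] theorem atomA_zero : atomA 0 = 0 := rfl
/-- Coordinate `1` of `(0,0,1)`. [folklore] -/
@[simp] theorem atomA_one : atomA 1 = 0 := rfl
/-- Coordinate `2` of `(0,0,1)`. [folklore] -/
@[simp] theorem atomA_two : atomA 2 = 1 := rfl
/-- Coordinate `0` of `(0,1,0)`. [folklore] -/
@[simp] theorem atomB_zero : atomB 0 = 0 := rfl
/-- Coordinate `1` of `(0,1,0)`. [folklore] -/
@[simp] theorem atomB_one : atomB 1 = 1 := rfl
/-- Coordinate `2` of `(0,1,0)`. [folklore] -/
@[simp] theorem atomB_two : atomB 2 = 0 := rfl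

/-- Evaluation of the example on a measurable set. [this work] -/
theorem cmsExample_apply {S : Set (Fin 3 → ℝ)} (hS : MeasurableSet S) :
    cmsExample S = 2⁻¹ * S.indicator 1 atomA + 2⁻¹ * S.indicator 1 atomB := by
  simp only [cmsExample, Measure.coe_add, Measure.coe_smul, Pi.add_apply, Pi.smul_apply, smul_eq_mul,
    Measure.dirac_apply' _ hS]

/-- The example is a probability measure. [this work] -/
instance isProbabilityMeasure_cmsExample : IsProbabilityMeasure cmsExample := by
  refine ⟨?_⟩
  rw [cmsExample_apply MeasurableSet.univ]
  simp only [Set.indicator_univ, Pi.one_apply, mul_one]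
  exact ENNReal.inv_two_add_inv_two

/-- The first coordinate of the example vanishes almost surely. [this work] -/
theorem cmsExample_ae_eval_zero : ∀ᵐ x ∂cmsExample, x 0 = 0 := by
  rw [ae_iff]
  have hS : MeasurableSet {x : Fin 3 → ℝ | ¬x 0 = 0} :=
    (measurableSet_eq_fun (measurable_pi_apply 0) measurable_const).compl
  rw [cmsExample_apply hS]
  simp [Set.indicator_of_notMem]

/-- **The example is CIS in the sense of Colangelo–Müller–Scarsini's Definition 4** (the tree's `IsCIS`).
[this work] -/
theorem isCIS_cmsExample : IsCIS cmsExample :=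
  isCIS_of_ae_eval_zero_eq_const cmsExample_ae_eval_zero

/-- … **but its coordinates `1` and `2` are negatively quadrant dependent**: `µ{x₂ > ½} µ{x₁ > ½} = ¼` while
`µ({x₂ > ½} ∩ {x₁ > ½}) µ(ℝ³) = 0`.  So the example violates axiom B1 (bivariate margins PQD) and is not
positively associated. [this work] -/
theorem cmsExample_not_pqd :
    ¬ cmsExample {x | (2⁻¹ : ℝ) < x 2} * cmsExample {x | (2⁻¹ : ℝ) < x 1} ≤
      cmsExample ({x | (2⁻¹ : ℝ) < x 2} ∩ {x | (2⁻¹ : ℝ) < x 1}) * cmsExample Set.univ := by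
  have h2 : MeasurableSet {x : Fin 3 → ℝ | (2⁻¹ : ℝ) < x 2} :=
    measurableSet_lt measurable_const (measurable_pi_apply 2)
  have h1 : MeasurableSet {x : Fin 3 → ℝ | (2⁻¹ : ℝ) < x 1} :=
    measurableSet_lt measurable_const (measurable_pi_apply 1)
  rw [cmsExample_apply h2, cmsExample_apply h1, cmsExample_apply (h2.inter h1), measure_univ]
  have hA2 : atomA ∈ {x : Fin 3 → ℝ | (2⁻¹ : ℝ) < x 2} := by norm_num [atomA_two]
  have hB2 : atomB ∉ {x : Fin 3 → ℝ | (2⁻¹ : ℝ) < x 2} := by norm_num [atomB_two]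
  have hA1 : atomA ∉ {x : Fin 3 → ℝ | (2⁻¹ : ℝ) < x 1} := by norm_num [atomA_one]
  have hB1 : atomB ∈ {x : Fin 3 → ℝ | (2⁻¹ : ℝ) < x 1} := by norm_num [atomB_one]
  have hAi : atomA ∉ {x : Fin 3 → ℝ | (2⁻¹ : ℝ) < x 2} ∩ {x | (2⁻¹ : ℝ) < x 1} := fun h => hA1 h.2
  have hBi : atomB ∉ {x : Fin 3 → ℝ | (2⁻¹ : ℝ) < x 2} ∩ {x | (2⁻¹ : ℝ) < x 1} := fun h => hB2 h.1
  simp only [Set.indicator_of_mem hA2, Set.indicator_of_notMem hB2, Set.indicator_of_notMem hA1,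
    Set.indicator_of_mem hB1, Set.indicator_of_notMem hAi, Set.indicator_of_notMem hBi, Pi.one_apply,
    mul_one, mul_zero, add_zero, zero_add, not_le]
  exact ENNReal.mul_pos (by norm_num) (by norm_num)

/-- Hence the example is **not** conditionally increasing given the single coordinate `X₁` (so it is not CI):
Definition 4 given one non-degenerate coordinate does imply PQD (`CondIncrGiven.pqd`, B1). [this work] -/
theorem not_condIncrGiven_cmsExample_one : ¬ CondIncrGiven cmsExample {(1 : Fin 3)} :=
  fun h => cmsExample_not_pqd (h.pqd 2 2⁻¹ 2⁻¹)

/-- The splitting map `x ↦ ((x₀, x₁), x₂)` from `ℝ³` to `ℝ² × ℝ`. [folklore] -/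
def split3 (x : Fin 3 → ℝ) : (Fin 2 → ℝ) × ℝ := (![x 0, x 1], x 2)

/-- The conditioning atom `(0, 0) ∈ ℝ²`. -/
def c00 : Fin 2 → ℝ := ![0, 0]

/-- The conditioning atom `(0, 1) ∈ ℝ²`. -/
def c01 : Fin 2 → ℝ := ![0, 1]

/-- The splitting map is measurable. [folklore] -/
theorem measurable_split3 : Measurable split3 := by
  refine Measurable.prodMk ?_ (measurable_pi_apply 2)
  refine measurable_pi_iff.2 fun i => ?_
  fin_cases i
  · exact measurable_pi_apply 0
  · exact measurable_pi_apply 1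

/-- `split3 (0,0,1) = ((0,0), 1)`. [folklore] -/
theorem split3_atomA : split3 atomA = (c00, 1) :=
  Prod.ext (funext fun i => by fin_cases i <;> rfl) rfl

/-- `split3 (0,1,0) = ((0,1), 0)`. [folklore] -/
theorem split3_atomB : split3 atomB = (c01, 0) :=
  Prod.ext (funext fun i => by fin_cases i <;> rfl) rfl

/-- The two conditioning atoms are ordered: `(0,0) ≤ (0,1)` in `ℝ²`. [folklore] -/
theorem c00_le_c01 : c00 ≤ c01 := by
  intro i; fin_cases i <;> norm_num [c00, c01]

/-- The two conditioning atoms are distinct. [folklore] -/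
theorem c00_ne_c01 : c00 ≠ c01 := by
  intro h
  have := congrFun h 1
  norm_num [c00, c01] at this

/-- The law of `((X₀, X₁), X₂)` under the example, as a measure on `ℝ² × ℝ` (`ℝ² = Fin 2 → ℝ`): the source's
`µ^{(3)}` viewed over `µ^{(2)}`. [this work] -/
def cmsExampleSplit : Measure ((Fin 2 → ℝ) × ℝ) := cmsExample.map split3

/-- The split law is a probability measure. [folklore] -/
instance isProbabilityMeasure_cmsExampleSplit : IsProbabilityMeasure cmsExampleSplit :=
  Measure.isProbabilityMeasure_map measurable_split3.aemeasurable

/-- The split law is `½ δ_{((0,0),1)} + ½ δ_{((0,1),0)}`. [this work] -/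
theorem cmsExampleSplit_eq :
    cmsExampleSplit = (2⁻¹ : ℝ≥0∞) • Measure.dirac (c00, (1 : ℝ)) + (2⁻¹ : ℝ≥0∞) • Measure.dirac (c01, (0 : ℝ)) := by
  rw [cmsExampleSplit, cmsExample, Measure.map_add _ _ measurable_split3, Measure.map_smul, Measure.map_smul,
    Measure.map_dirac' measurable_split3, Measure.map_dirac' measurable_split3, split3_atomA, split3_atomB]

/-- Evaluation of the split law on a measurable set. [this work] -/
theorem cmsExampleSplit_apply {S : Set ((Fin 2 → ℝ) × ℝ)} (hS : MeasurableSet S) :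
    cmsExampleSplit S = 2⁻¹ * S.indicator 1 (c00, (1 : ℝ)) + 2⁻¹ * S.indicator 1 (c01, (0 : ℝ)) := by
  rw [cmsExampleSplit_eq]
  simp only [Measure.coe_add, Measure.coe_smul, Pi.add_apply, Pi.smul_apply, smul_eq_mul,
    Measure.dirac_apply' _ hS]

/-- The first marginal of the split law on a measurable set: `½ δ_{(0,0)} + ½ δ_{(0,1)}`. [this work] -/
theorem cmsExampleSplit_fst_apply {S : Set (Fin 2 → ℝ)} (hS : MeasurableSet S) :
    cmsExampleSplit.fst S = 2⁻¹ * S.indicator 1 c00 + 2⁻¹ * S.indicator 1 c01 := by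
  rw [Measure.fst_apply hS, cmsExampleSplit_apply (measurable_fst hS)]
  rfl

/-- Under ANY disintegration kernel `K` of the split law (`µ^{(2)} ⊗ₘ K = µ^{(3)}`):
`K(a)((-∞,½]) · µ^{(2)}{a} = µ^{(3)}({a} × (-∞,½])`. [this work] -/
theorem kernel_singleton_identity {κ : Kernel (Fin 2 → ℝ) ℝ} [IsSFiniteKernel κ]
    (hdis : cmsExampleSplit.fst ⊗ₘ κ = cmsExampleSplit) (a : Fin 2 → ℝ) :
    κ a (Iic (2⁻¹ : ℝ)) * cmsExampleSplit.fst {a} = cmsExampleSplit ({a} ×ˢ Iic (2⁻¹ : ℝ)) := by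
  have h := congrArg (fun ν : Measure ((Fin 2 → ℝ) × ℝ) => ν ({a} ×ˢ Iic (2⁻¹ : ℝ))) hdis
  rw [Measure.compProd_apply_prod (measurableSet_singleton a) measurableSet_Iic, lintegral_singleton] at h
  exact h

/-- Any disintegration kernel of the split law puts NO mass below `½` at the atom `(0,0)` (the conditional law
there is `δ₁`). [this work] -/
theorem kernel_c00 {κ : Kernel (Fin 2 → ℝ) ℝ} [IsSFiniteKernel κ]
    (hdis : cmsExampleSplit.fst ⊗ₘ κ = cmsExampleSplit) : κ c00 (Iic (2⁻¹ : ℝ)) = 0 := by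
  have h := kernel_singleton_identity hdis c00
  have hprod : MeasurableSet (({c00} : Set (Fin 2 → ℝ)) ×ˢ Iic (2⁻¹ : ℝ)) :=
    (measurableSet_singleton c00).prod measurableSet_Iic
  rw [cmsExampleSplit_fst_apply (measurableSet_singleton c00), cmsExampleSplit_apply hprod] at h
  have h1 : (c00, (1 : ℝ)) ∉ ({c00} : Set (Fin 2 → ℝ)) ×ˢ Iic (2⁻¹ : ℝ) := by
    intro hm; have := (Set.mem_prod.1 hm).2; norm_num at this
  have h2 : (c01, (0 : ℝ)) ∉ ({c00} : Set (Fin 2 → ℝ)) ×ˢ Iic (2⁻¹ : ℝ) := by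
    intro hm; exact c00_ne_c01 (Set.mem_singleton_iff.1 (Set.mem_prod.1 hm).1).symm
  have h3 : c01 ∉ ({c00} : Set (Fin 2 → ℝ)) := fun hm => c00_ne_c01 (Set.mem_singleton_iff.1 hm).symm
  rw [Set.indicator_of_notMem h1, Set.indicator_of_notMem h2, Set.indicator_of_mem (Set.mem_singleton c00),
    Set.indicator_of_notMem h3] at h
  have h' : κ c00 (Iic (2⁻¹ : ℝ)) * 2⁻¹ = 0 := by simpa using h
  have h2ne : (2⁻¹ : ℝ≥0∞) ≠ 0 := by norm_num
  rcases mul_eq_zero.1 h' with h'' | h''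
  · exact h''
  · exact absurd h'' h2ne

/-- Any disintegration kernel of the split law puts ALL its mass below `½` at the atom `(0,1)` (the conditional law
there is `δ₀`). [this work] -/
theorem kernel_c01 {κ : Kernel (Fin 2 → ℝ) ℝ} [IsSFiniteKernel κ]
    (hdis : cmsExampleSplit.fst ⊗ₘ κ = cmsExampleSplit) : κ c01 (Iic (2⁻¹ : ℝ)) = 1 := by
  have h := kernel_singleton_identity hdis c01
  have hprod : MeasurableSet (({c01} : Set (Fin 2 → ℝ)) ×ˢ Iic (2⁻¹ : ℝ)) :=
    (measurableSet_singleton c01).prod measurableSet_Iic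
  rw [cmsExampleSplit_fst_apply (measurableSet_singleton c01), cmsExampleSplit_apply hprod] at h
  have h1 : (c00, (1 : ℝ)) ∉ ({c01} : Set (Fin 2 → ℝ)) ×ˢ Iic (2⁻¹ : ℝ) := by
    intro hm; exact c00_ne_c01 (Set.mem_singleton_iff.1 (Set.mem_prod.1 hm).1)
  have h2 : (c01, (0 : ℝ)) ∈ ({c01} : Set (Fin 2 → ℝ)) ×ˢ Iic (2⁻¹ : ℝ) :=
    Set.mem_prod.2 ⟨Set.mem_singleton c01, by norm_num⟩
  have h3 : c00 ∉ ({c01} : Set (Fin 2 → ℝ)) := fun hm => c00_ne_c01 (Set.mem_singleton_iff.1 hm)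
  rw [Set.indicator_of_notMem h1, Set.indicator_of_mem h2, Set.indicator_of_notMem h3,
    Set.indicator_of_mem (Set.mem_singleton c01)] at h
  have h2ne : (2⁻¹ : ℝ≥0∞) ≠ 0 := by norm_num
  have h2top : (2⁻¹ : ℝ≥0∞) ≠ ⊤ := by norm_num
  have h' : κ c01 (Iic (2⁻¹ : ℝ)) * 2⁻¹ = 1 * 2⁻¹ := by simpa using h
  exact (ENNReal.mul_left_inj h2ne h2top).1 h'

/-- **Theorem 4 (a) ⇒ (b) of the source fails for the example**: there is NO stochastically increasing Markov kernel
`K` on `ℝ² × Bor(ℝ)` with `µ^{(3)} = µ^{(2)} ∗ K` (`µ^{(2)} ⊗ₘ K = µ^{(3)}`), although `µ` is CIS in the sense of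
Definition 4 (`isCIS_cmsExample`): any disintegration kernel has `K((0,0)) = δ₁` and `K((0,1)) = δ₀` at the two
atoms of `µ^{(2)}`, and `(0,0) ≤ (0,1)`.  (Not even a kernel that is stochastically increasing outside a
`µ^{(2)}`-null set exists: the two atoms are not null.) [this work] -/
theorem cmsExample_no_increasing_kernel :
    ¬ ∃ κ : Kernel (Fin 2 → ℝ) ℝ, IsMarkovKernel κ ∧ cmsExampleSplit.fst ⊗ₘ κ = cmsExampleSplit ∧
      ∀ a b : Fin 2 → ℝ, a ≤ b → ∀ t : ℝ, κ b (Iic t) ≤ κ a (Iic t) := by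
  rintro ⟨κ, hκ, hdis, hmono⟩
  have := hmono c00 c01 c00_le_c01 2⁻¹
  rw [kernel_c00 hdis, kernel_c01 hdis] at this
  exact absurd this (by norm_num)

end Example

end Summit.CriticalPhenomena.PercolationContinuityZ3.Theorems.SahiCIS

end
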